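import Literature.NumberTheory.NumberFields.HilbertClassFieldCentralModP
import Literature.NumberTheory.NumberFields.HilbertClassFieldOfGaloisExtension
import Literature.NumberTheory.NumberFields.HilbertClassFieldMaximal
import Literature.NumberTheory.NumberFields.ClassNumberPExtensionOnePrime
import Literature.NumberTheory.NumberFields.UnramifiedAbelianBaseChange
import HarnessLib

/-!
# If `Gal(M/k)` acts trivially on `Cl(M)/p`, then for every Galois `E ⊇ M` unramified at infinity over `M` the quotient
# `Gal(E/M)/(G'·⟨I(𝔔)⟩·G^p)` is CENTRALISED by `Gal(E/k)` (door L11 step (iii-b) of the cell `bsd-potss`; proved)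

`Proofs`-style file (theorems only: no definition, no named fact, no `sorry`) in topic `NumberTheory/NumberFields`
(namespace `Literature.NumberTheory.NumberFields`), written by the literature seat `bsd-potss-conjA-anchor` g21 (cell `bsd-potss`;
serves the asides stmt-BirchSwinnertonDyer-19386 / 19413; closes nothing).  Sequel of `HilbertClassFieldCentralModP` (conjA-anchor g20,
step (iii-a): for `H = hilbertClassField M ⊆ \bar M`, «every `σ ∈ Gal(M/k)` trivial on `Cl(M)/p`» gives
`⁅Gal(H/k), Gal(H/M)⁆ ≤ ⟨x^p : x ∈ Gal(H/M)⟩`).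

THE THEOREM (`commutator_top_range_le_map_of_classGroup_mulEquiv`).  `k ⊆ M ⊆ E` number fields, `E/k` and `M/k` finite Galois,
`E/M` unramified at the infinite places; `G = Gal(E/M)` embedded in `Gal(E/k)` by restriction of scalars (`ρ`); `N = G'·⟨I(𝔔) : 𝔔⟩`
(commutators and the inertia groups in `G` of all maximal ideals of `𝓞 E`) and `N·G^p` (`G^p` = the subgroup generated by the `p`-th
powers).  IF every `σ ∈ Gal(M/k)` acts trivially on `Cl(𝓞 M)/Cl(𝓞 M)^p` (`σc · c⁻¹ ∈ Cl^p`), THEN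
`⁅Gal(E/k), ρ(G)⁆ ≤ ρ(N·G^p)`: the quotient `G/N·G^p` — by class field theory the Galois group over `M` of the maximal unramified
elementary-abelian `p`-extension of `M` INSIDE `E` — is centralised by the conjugation action of `Gal(E/k)`.

USE (cell `bsd-potss`, door L11): with `k = K_n`, `M = K_{n+j}`, `E = H_p(K_{n+t})` (Fukuda's package, `Fukuda1994Thm1RankLayer.exists_layer`)
this is the hypothesis `⁅G, G_j⁆ ≤ N_j P_j` of `FukudaGroup.relIndex_layer_le_of_commutator_le` (conjA-anchor g20), i.e. the nilpotency-index
form of the one-layer `μ = 0` criterion.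

PROOF.  `N' = N·G^p` contains `G'`, so `F = E^{N'}` is an abelian extension of `M` of exponent `p`, unramified at every finite prime
(`I(𝔔) ≤ N' = Gal(E/F)`, tree `isUnramifiedAt_under_iff_inertia_le'`) and at the infinite places (sub-extension of `E/M`) — exactly as
in `FukudaRankCountingLemmas.index_sup_pow_dvd_index_range_pow` (k8t-c4 g20).  `N'` is stable under conjugation by `Aut(E/k)` (commutators
to commutators, `p`-th powers to `p`-th powers, `I(𝔔) ↦ I(τ𝔔)`), so `ρ(N')` is normal in `Gal(E/k)` and `F/k` is normal.  A copy
`F♭ ⊆ \bar M` of `F` lies in `hilbertClassField M` (maximality, tree `hilbertClassField.le_hilbertClassField`); by step (iii-a)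
(`hilbertClassField.exists_eq_pow_mul_of_classGroup_mulEquiv`) conjugation by any automorphism of `H_M` over `σ ∈ Gal(M/k)` moves an
element of `Gal(H_M/M)` by a `p`-th power, which dies in `Gal(F/M)` (exponent `p`): `Gal(F/M)` is CENTRAL in `Gal(F/k)`.  Hence for
`τ ∈ Gal(E/k)`, `a ∈ G`: `⁅τ, a⁆` acts trivially on `F`, i.e. lies in `Gal(E/F) = N'`.

References: [NeukirchANT1999] J. Neukirch, *Algebraic Number Theory* (1999), Ch. IV §6 (functoriality of the norm residue symbol), Ch. VI §7
Thm. (7.1), §6 Prop. (6.9); [Cox2013] D. A. Cox, *Primes of the form x² + ny²*, 2nd ed., §5.C Cor. 5.24, §8.A Thm. 8.10; [Washington1997]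
L. Washington, *Introduction to Cyclotomic Fields*, 2nd ed., §13.3 Lemma 13.15, Prop. 13.22 (the `Γ`-module `X/(ν_n Y + pX)`);
[SerreLocalFields1979] J.-P. Serre, *Local Fields*, Ch. I §7 Prop. 21–22.
-/

set_option autoImplicit false

noncomputable section

open scoped NumberField commutatorElement
open NumberField IsDedekindDomain Field IntermediateField

namespace Literature.NumberTheory.NumberFields

/-! ## §1 Galois plumbing: central modulo `p`-th powers upstairs, exponent `p` downstairs -/

section CentralModPow

variable {k F E H : Type*} [Field k] [Field F] [Field E] [Field H]
  [Algebra k F] [Algebra k E] [Algebra k H] [Algebra F E] [Algebra F H] [Algebra E H]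
  [IsScalarTower k F E] [IsScalarTower k F H] [IsScalarTower k E H] [IsScalarTower F E H]
  [IsGalois k H] [Normal k E] [Normal k F]

/-- `k ⊆ F ⊆ E ⊆ H`, `H/k` finite Galois, `E/k` and `F/k` normal.  If conjugation by every `τ̃ ∈ Gal(H/k)` moves every `ã ∈ Gal(H/F)`
only by a `p`-th power of `Gal(H/F)`, and `Gal(E/F)` has exponent `p`, then `Gal(E/F)` is central in `Gal(E/k)`. [folklore] -/
private theorem conj_eq_of_central_mod_pow (p : ℕ)
    (hcent : ∀ (τ : H ≃ₐ[k] H) (a a' : H ≃ₐ[F] H), (∀ y, a' y = τ (a (τ.symm y))) →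
      ∃ e : H ≃ₐ[F] H, a' = e ^ p * a)
    (hexp : ∀ b : E ≃ₐ[F] E, b ^ p = 1)
    (τ : E ≃ₐ[k] E) (b b' : E ≃ₐ[F] E) (hb' : ∀ y, b' y = τ (b (τ.symm y))) : b' = b := by
  classical
  haveI : Normal F H := Normal.tower_top_of_normal k F H
  haveI : Normal F E := Normal.tower_top_of_normal k F E
  -- lift `τ` and `b` to `H`
  set τH : H ≃ₐ[k] H := τ.liftNormal H with hτH
  set bH : H ≃ₐ[F] H := b.liftNormal H with hbH
  have hτH_res : ∀ x : E, τH (algebraMap E H x) = algebraMap E H (τ x) := fun x => AlgEquiv.liftNormal_commutes τ H x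
  have hbH_res : ∀ x : E, bH (algebraMap E H x) = algebraMap E H (b x) := fun x => AlgEquiv.liftNormal_commutes b H x
  have hτH_symm_res : ∀ x : E, τH.symm (algebraMap E H x) = algebraMap E H (τ.symm x) := by
    intro x
    apply τH.injective
    rw [AlgEquiv.apply_symm_apply, hτH_res, AlgEquiv.apply_symm_apply]
  -- the conjugate of `bH` by `τH`, as an `F`-automorphism of `H`
  have hτH_F : ∀ z : F, τH (algebraMap F H z) = algebraMap F H ((τ.restrictNormal F) z) := by
    intro z
    rw [IsScalarTower.algebraMap_apply F E H z, hτH_res, ← AlgEquiv.restrictNormal_commutes τ F z,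
      ← IsScalarTower.algebraMap_apply F E H]
  have hτH_symm_F : ∀ z : F, τH.symm (algebraMap F H z) = algebraMap F H ((τ.restrictNormal F).symm z) := by
    intro z
    apply τH.injective
    rw [AlgEquiv.apply_symm_apply, hτH_F, AlgEquiv.apply_symm_apply]
  let bH' : H ≃ₐ[F] H :=
    AlgEquiv.ofRingEquiv (f := τH.symm.toRingEquiv.trans (bH.toRingEquiv.trans τH.toRingEquiv)) fun z => by
      change τH (bH (τH.symm (algebraMap F H z))) = algebraMap F H z
      rw [hτH_symm_F, AlgEquiv.commutes, hτH_F, AlgEquiv.apply_symm_apply]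
  have hbH' : ∀ y, bH' y = τH (bH (τH.symm y)) := fun _ => rfl
  obtain ⟨e, he⟩ := hcent τH bH bH' hbH'
  -- restrict `e` to `E`
  set eE : E ≃ₐ[F] E := e.restrictNormal E with heE
  have heE_res : ∀ x : E, algebraMap E H (eE x) = e (algebraMap E H x) := fun x => AlgEquiv.restrictNormal_commutes e E x
  have hpow_res : ∀ (m : ℕ) (x : E), algebraMap E H ((eE ^ m) x) = (e ^ m) (algebraMap E H x) := by
    intro m
    induction m with
    | zero => intro x; rfl
    | succ m ih => intro x; rw [pow_succ, pow_succ, AlgEquiv.mul_apply, AlgEquiv.mul_apply, ih, heE_res]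
  -- compare on `E` through the injection `E → H`
  apply AlgEquiv.ext
  intro y
  apply (algebraMap E H).injective
  have h1 : algebraMap E H (b' y) = bH' (algebraMap E H y) := by
    rw [hb', hbH', hτH_symm_res, hbH_res, hτH_res]
  rw [h1, he, AlgEquiv.mul_apply, hbH_res, ← hpow_res, hexp eE, AlgEquiv.one_apply]

end CentralModPow

/-! ## §2 Galois plumbing: centrality of `Gal(E^N/F')` puts the commutators `⁅Aut(E/k'), Gal(E/F')⁆` inside `N` -/

section CommutatorMem

variable {k' F' L : Type*} [Field k'] [Field F'] [Field L] [Algebra k' F'] [Algebra k' L] [Algebra F' L]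
  [IsScalarTower k' F' L] [FiniteDimensional F' L] [IsGalois F' L] [Normal k' F']

/-- `L/F'` finite Galois, `F'/k'` normal, `N ⊴ Gal(L/F')`, `E = L^N`; `ρ` = restriction of scalars `Gal(L/F') → Aut_{k'}(L)`.
If `E/k'` is normal and `Gal(E/F')` is central in `Gal(E/k')` (conjugation by any `k'`-automorphism of `E` fixes every
`F'`-automorphism of `E`), then `⁅τ, ρ a⁆ ∈ ρ(N)` for all `τ ∈ Aut_{k'}(L)`, `a ∈ Gal(L/F')`. [folklore] -/
private theorem commutator_mem_map_of_central (N : Subgroup (L ≃ₐ[F'] L)) [N.Normal]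
    (E : IntermediateField F' L) (hE : E = IntermediateField.fixedField N) [Normal k' E]
    (ρ : (L ≃ₐ[F'] L) →* (L ≃ₐ[k'] L)) (hρ : ∀ a y, ρ a y = a y)
    (hcentE : ∀ (τ : E ≃ₐ[k'] E) (b b' : E ≃ₐ[F'] E), (∀ y, b' y = τ (b (τ.symm y))) → b' = b)
    (τ : L ≃ₐ[k'] L) (a : L ≃ₐ[F'] L) : ⁅τ, ρ a⁆ ∈ N.map ρ := by
  classical
  haveI : Normal F' E := by rw [hE]; exact (IsGalois.of_fixedField_normal_subgroup N).to_normal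
  haveI : IsScalarTower k' E L := IsScalarTower.of_algebraMap_eq fun x => by
    rw [IsScalarTower.algebraMap_apply k' F' L x, IsScalarTower.algebraMap_apply k' F' E x,
      ← IsScalarTower.algebraMap_apply F' E L]
  -- `τ` on `F'`
  have hτF : ∀ z : F', τ (algebraMap F' L z) = algebraMap F' L ((τ.restrictNormal F') z) := fun z =>
    (AlgEquiv.restrictNormal_commutes τ F' z).symm
  have hτF_symm : ∀ z : F', τ.symm (algebraMap F' L z) = algebraMap F' L ((τ.restrictNormal F').symm z) := by
    intro z; apply τ.injective; rw [AlgEquiv.apply_symm_apply, hτF, AlgEquiv.apply_symm_apply]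
  -- the conjugate `a' = τ a τ⁻¹` as an `F'`-automorphism
  let a' : L ≃ₐ[F'] L :=
    AlgEquiv.ofRingEquiv (f := τ.symm.toRingEquiv.trans (a.toRingEquiv.trans τ.toRingEquiv)) fun z => by
      change τ (a (τ.symm (algebraMap F' L z))) = algebraMap F' L z
      rw [hτF_symm, AlgEquiv.commutes, hτF, AlgEquiv.apply_symm_apply]
  have ha' : ∀ y, a' y = τ (a (τ.symm y)) := fun _ => rfl
  have hconj : τ * ρ a * τ⁻¹ = ρ a' := by
    apply AlgEquiv.ext; intro y
    rw [AlgEquiv.mul_apply, AlgEquiv.mul_apply, hρ, hρ, ha']; rfl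
  have hcomm : ⁅τ, ρ a⁆ = ρ (a' * a⁻¹) := by
    rw [commutatorElement_def, hconj, map_mul, map_inv]
  rw [hcomm]
  refine ⟨a' * a⁻¹, ?_, rfl⟩
  -- `a' a⁻¹ ∈ N = fixingSubgroup E`: `a'` and `a` agree on `E`
  have hN : N = E.fixingSubgroup := by rw [hE, IntermediateField.fixingSubgroup_fixedField]
  rw [SetLike.mem_coe, hN, IntermediateField.mem_fixingSubgroup_iff]
  intro y hy
  -- restrict to `E`
  set τE : E ≃ₐ[k'] E := τ.restrictNormal E with hτE
  set b : E ≃ₐ[F'] E := a.restrictNormal E with hb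
  set b' : E ≃ₐ[F'] E := a'.restrictNormal E with hb'
  have hτE_res : ∀ x : E, algebraMap E L (τE x) = τ (algebraMap E L x) := fun x => AlgEquiv.restrictNormal_commutes τ E x
  have hτE_symm_res : ∀ x : E, algebraMap E L (τE.symm x) = τ.symm (algebraMap E L x) := by
    intro x; apply τ.injective
    rw [AlgEquiv.apply_symm_apply, ← hτE_res, AlgEquiv.apply_symm_apply]
  have hb_res : ∀ x : E, algebraMap E L (b x) = a (algebraMap E L x) := fun x => AlgEquiv.restrictNormal_commutes a E x
  have hb'_res : ∀ x : E, algebraMap E L (b' x) = a' (algebraMap E L x) := fun x => AlgEquiv.restrictNormal_commutes a' E x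
  have hbb' : ∀ x, b' x = τE (b (τE.symm x)) := by
    intro x
    apply (algebraMap E L).injective
    rw [hb'_res, ha', hτE_res, hb_res, hτE_symm_res]
  have heq : b' = b := hcentE τE b b' hbb'
  -- conclude on `y ∈ E`
  set x : E := b.symm ⟨y, hy⟩ with hx
  have hxL : algebraMap E L x = a.symm y := by
    apply a.injective
    rw [AlgEquiv.apply_symm_apply, ← hb_res, hx, AlgEquiv.apply_symm_apply]
    rfl
  rw [AlgEquiv.mul_apply, show a⁻¹ y = a.symm y from rfl, ← hxL, ← hb'_res, heq, hb_res, hxL, AlgEquiv.apply_symm_apply]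

end CommutatorMem

/-! ## §3 The subgroup `G'·⟨I(𝔔)⟩·G^p` of `G = Gal(E/M)` is stable under conjugation by `Aut(E/k)` -/

section Stability

variable {k M E : Type*} [Field k] [Field M] [Field E] [Algebra k M] [Algebra k E] [Algebra M E]
  [IsScalarTower k M E] [Normal k M]

/-- Conjugation by `τ ∈ Aut_k(E)` (`M/k` normal) as an endomorphism `θ` of the group `Gal(E/M)`: `(θ a) y = τ (a (τ⁻¹ y))`. [folklore] -/
private theorem exists_conjHom (τ : E ≃ₐ[k] E) :
    ∃ θ : (E ≃ₐ[M] E) →* (E ≃ₐ[M] E), ∀ a y, θ a y = τ (a (τ.symm y)) := by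
  have hτF : ∀ z : M, τ (algebraMap M E z) = algebraMap M E ((τ.restrictNormal M) z) := fun z =>
    (AlgEquiv.restrictNormal_commutes τ M z).symm
  have hτF_symm : ∀ z : M, τ.symm (algebraMap M E z) = algebraMap M E ((τ.restrictNormal M).symm z) := by
    intro z; apply τ.injective; rw [AlgEquiv.apply_symm_apply, hτF, AlgEquiv.apply_symm_apply]
  have hlin : ∀ (a : E ≃ₐ[M] E) (z : M),
      (τ.symm.toRingEquiv.trans (a.toRingEquiv.trans τ.toRingEquiv)) (algebraMap M E z) = algebraMap M E z := by
    intro a z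
    change τ (a (τ.symm (algebraMap M E z))) = algebraMap M E z
    rw [hτF_symm, AlgEquiv.commutes, hτF, AlgEquiv.apply_symm_apply]
  refine ⟨{ toFun := fun a => AlgEquiv.ofRingEquiv (f := τ.symm.toRingEquiv.trans (a.toRingEquiv.trans τ.toRingEquiv)) (hlin a)
            map_one' := ?_
            map_mul' := ?_ }, fun a y => rfl⟩
  · apply AlgEquiv.ext
    intro y
    change τ ((1 : E ≃ₐ[M] E) (τ.symm y)) = y
    rw [AlgEquiv.one_apply, AlgEquiv.apply_symm_apply]
  · intro a b
    apply AlgEquiv.ext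
    intro y
    change τ ((a * b) (τ.symm y)) = τ (a (τ.symm (τ (b (τ.symm y)))))
    rw [AlgEquiv.mul_apply, AlgEquiv.symm_apply_apply]

omit [Algebra k M] [IsScalarTower k M E] [Normal k M] in
/-- **`θ_τ(G'·⟨I(𝔔)⟩·G^p) ≤ G'·⟨I(𝔔)⟩·G^p`**: conjugation by `τ ∈ Aut_k(E)` maps commutators of `G = Gal(E/M)` to commutators, `p`-th
powers to `p`-th powers, and the inertia group `I(𝔔) ≤ G` onto `I(τ𝔔)`. [folklore]
[cite: NeukirchANT1999, Ch. I §9 (conjugate primes have conjugate inertia groups)] -/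
private theorem map_conjHom_le (p : ℕ) (τ : E ≃ₐ[k] E) (θ : (E ≃ₐ[M] E) →* (E ≃ₐ[M] E))
    (hθ : ∀ a y, θ a y = τ (a (τ.symm y))) :
    ((⁅(⊤ : Subgroup (E ≃ₐ[M] E)), ⊤⁆ ⊔ ⨆ (Q : MaximalSpectrum (𝓞 E)), Q.asIdeal.inertia (E ≃ₐ[M] E)) ⊔
        Subgroup.closure (Set.range fun σ : E ≃ₐ[M] E => σ ^ p)).map θ ≤
      (⁅(⊤ : Subgroup (E ≃ₐ[M] E)), ⊤⁆ ⊔ ⨆ (Q : MaximalSpectrum (𝓞 E)), Q.asIdeal.inertia (E ≃ₐ[M] E)) ⊔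
        Subgroup.closure (Set.range fun σ : E ≃ₐ[M] E => σ ^ p) := by
  classical
  rw [Subgroup.map_sup, Subgroup.map_sup]
  refine sup_le (sup_le ?_ ?_) ?_
  · -- commutators
    rw [Subgroup.map_commutator]
    exact le_sup_of_le_left (le_sup_of_le_left (Subgroup.commutator_mono le_top le_top))
  · -- inertia groups
    rw [Subgroup.map_iSup]
    refine iSup_le fun Q => ?_
    haveI := Q.isMaximal
    obtain ⟨e, he⟩ : ∃ e : 𝓞 E ≃+* 𝓞 E, e = AmbiguousClass.intAut τ := ⟨_, rfl⟩
    have hQ' : (Q.asIdeal.map (e : 𝓞 E →+* 𝓞 E)).IsMaximal := Ideal.IsMaximal.map_bijective _ e.bijective Q.isMaximal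
    let Q' : MaximalSpectrum (𝓞 E) := ⟨_, hQ'⟩
    have hle : (Q.asIdeal.inertia (E ≃ₐ[M] E)).map θ ≤ Q'.asIdeal.inertia (E ≃ₐ[M] E) := by
      rintro _ ⟨g, hg, rfl⟩ y
      change θ g • y - y ∈ Q.asIdeal.map (e : 𝓞 E →+* 𝓞 E)
      rw [Ideal.map_comap_of_equiv, Ideal.mem_comap, map_sub]
      have h1 : e.symm (θ g • y) = g • e.symm y := by
        apply Subtype.ext
        rw [he]
        change τ.symm ((θ g) (y : E)) = g (τ.symm (y : E))
        rw [hθ, AlgEquiv.symm_apply_apply]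
      rw [h1]
      exact hg (e.symm y)
    exact le_sup_of_le_left (le_sup_of_le_right
      (hle.trans (le_iSup (fun Q : MaximalSpectrum (𝓞 E) => Q.asIdeal.inertia (E ≃ₐ[M] E)) Q')))
  · -- `p`-th powers
    rw [MonoidHom.map_closure]
    refine le_sup_of_le_right (Subgroup.closure_mono ?_)
    rintro _ ⟨_, ⟨σ, rfl⟩, rfl⟩
    exact ⟨θ σ, by rw [map_pow]⟩

/-- **`ρ(G'·⟨I(𝔔)⟩·G^p)` is normal in `Gal(E/k)`** (`ρ : Gal(E/M) → Gal(E/k)` restriction of scalars, `M/k` normal). [folklore] -/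
private theorem normal_map_commutator_sup_inertia_sup_pow (p : ℕ) (ρ : (E ≃ₐ[M] E) →* (E ≃ₐ[k] E))
    (hρ : ∀ a y, ρ a y = a y) :
    (((⁅(⊤ : Subgroup (E ≃ₐ[M] E)), ⊤⁆ ⊔ ⨆ (Q : MaximalSpectrum (𝓞 E)), Q.asIdeal.inertia (E ≃ₐ[M] E)) ⊔
        Subgroup.closure (Set.range fun σ : E ≃ₐ[M] E => σ ^ p)).map ρ).Normal := by
  refine ⟨fun x hx τ => ?_⟩
  obtain ⟨n, hn, rfl⟩ := hx
  obtain ⟨θ, hθ⟩ := exists_conjHom (k := k) (M := M) (E := E) τ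
  refine ⟨θ n, map_conjHom_le p τ θ hθ ⟨n, hn, rfl⟩, ?_⟩
  apply AlgEquiv.ext
  intro y
  rw [hρ, hθ, AlgEquiv.mul_apply, AlgEquiv.mul_apply, hρ]
  rfl

end Stability

/-! ## §4 The theorem -/

section Main

variable (k M E : Type) [Field k] [Field M] [NumberField M] [Field E] [NumberField E]
  [Algebra k M] [Algebra k E] [Algebra M E] [IsScalarTower k M E]
  [IsGalois k E] [IsGalois k M] [FiniteDimensional M E] [IsGalois M E] [IsUnramifiedAtInfinitePlaces M E]

set_option maxHeartbeats 1600000 in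
set_option synthInstance.maxHeartbeats 200000 in
/-- **Centrality of the unramified elementary-abelian `p`-quotient.**  `k ⊆ M ⊆ E` number fields with `E/k` and `M/k` finite Galois and
`E/M` unramified at the infinite places; `G = Gal(E/M)`, `ρ : G → Gal(E/k)` restriction of scalars, `N = G'·⟨I(𝔔) : 𝔔 ⊂ 𝓞 E maximal⟩`,
`G^p = ⟨σ^p⟩`.  If every `σ ∈ Gal(M/k)` acts trivially on `Cl(𝓞 M)/Cl(𝓞 M)^p` (`σc·c⁻¹ ∈ Cl^p`), then
`⁅Gal(E/k), ρ(G)⁆ ≤ ρ(N·G^p)`: the Galois group `G/N·G^p` of the maximal unramified elementary-abelian `p`-extension of `M` inside `E`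
is centralised by `Gal(E/k)`.  (Class field theory: `G/N·G^p` is an equivariant quotient of `Cl(𝓞 M)/Cl^p` — Artin reciprocity is
functorial in automorphisms, Neukirch IV §6 — on which `Gal(M/k)` acts trivially by hypothesis.)
[cite: NeukirchANT1999, Ch. IV §6 and Ch. VI §7 Thm. (7.1), §6 Prop. (6.9)] [cite: Cox2013, §5.C Cor. 5.24 and §8.A Thm. 8.10]
[cite: Washington1997, §13.3 Lemma 13.15 and Prop. 13.22] -/
theorem commutator_top_range_le_map_of_classGroup_mulEquiv (p : ℕ)
    (hσ : ∀ (σ : M ≃ₐ[k] M) (c : ClassGroup (𝓞 M)),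
      ClassGroup.mulEquiv (AmbiguousClass.intAut σ) c * c⁻¹ ∈ (powMonoidHom p : ClassGroup (𝓞 M) →* ClassGroup (𝓞 M)).range)
    (ρ : (E ≃ₐ[M] E) →* (E ≃ₐ[k] E)) (hρ : ∀ a y, ρ a y = a y) :
    ⁅(⊤ : Subgroup (E ≃ₐ[k] E)), ρ.range⁆ ≤
      ((⁅(⊤ : Subgroup (E ≃ₐ[M] E)), ⊤⁆ ⊔ ⨆ (Q : MaximalSpectrum (𝓞 E)), Q.asIdeal.inertia (E ≃ₐ[M] E)) ⊔
        Subgroup.closure (Set.range fun σ : E ≃ₐ[M] E => σ ^ p)).map ρ := by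
  classical
  -- ### the subgroup `N' = G'·⟨I(𝔔)⟩·G^p` and its fixed field `F`
  set N' : Subgroup (E ≃ₐ[M] E) :=
    (⁅(⊤ : Subgroup (E ≃ₐ[M] E)), ⊤⁆ ⊔ ⨆ (Q : MaximalSpectrum (𝓞 E)), Q.asIdeal.inertia (E ≃ₐ[M] E)) ⊔
      Subgroup.closure (Set.range fun σ : E ≃ₐ[M] E => σ ^ p) with hN'
  have hcomm' : ⁅(⊤ : Subgroup (E ≃ₐ[M] E)), ⊤⁆ ≤ N' := le_sup_of_le_left le_sup_left
  have hIN : ∀ (Q : Ideal (𝓞 E)) [Q.IsMaximal], Q.inertia (E ≃ₐ[M] E) ≤ N' := fun Q _ =>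
    le_sup_of_le_left (le_sup_of_le_right
      (le_iSup (fun Q : MaximalSpectrum (𝓞 E) => Q.asIdeal.inertia (E ≃ₐ[M] E)) ⟨Q, ‹_›⟩))
  haveI hN'n : N'.Normal := ⟨fun m hm g => by
    have h2 := Subgroup.commutator_mem_commutator (Subgroup.mem_top g) (Subgroup.mem_top m)
    rw [commutatorElement_def] at h2
    have h1 : g * m * g⁻¹ = g * m * g⁻¹ * m⁻¹ * m := by group
    rw [h1]
    exact mul_mem (hcomm' h2) hm⟩
  set F : IntermediateField M E := IntermediateField.fixedField N' with hF
  haveI : IsGalois M F := IsGalois.of_fixedField_normal_subgroup N'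
  -- `Gal(F/M) ≅ G/N'` is commutative and killed by `p`
  haveI : IsAbelianGalois M F := by
    refine { is_comm := ⟨fun x y => ?_⟩ }
    obtain ⟨x', rfl⟩ := (IsGalois.normalAutEquivQuotient N').surjective x
    obtain ⟨y', rfl⟩ := (IsGalois.normalAutEquivQuotient N').surjective y
    rw [← map_mul, ← map_mul]
    congr 1
    have hc : IsMulCommutative ((E ≃ₐ[M] E) ⧸ N') := by
      rw [Subgroup.Normal.quotient_commutative_iff_commutator_le, commutator_def]
      exact hcomm'
    exact hc.is_comm.comm x' y'
  have hexp : ∀ x : F ≃ₐ[M] F, x ^ p = 1 := by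
    intro x
    obtain ⟨x', rfl⟩ := (IsGalois.normalAutEquivQuotient N').surjective x
    obtain ⟨σ, rfl⟩ := QuotientGroup.mk_surjective x'
    rw [← map_pow, ← QuotientGroup.mk_pow, (QuotientGroup.eq_one_iff _).mpr, map_one]
    exact Subgroup.mem_sup_right (Subgroup.subset_closure ⟨σ, rfl⟩)
  haveI : IsUnramifiedAtInfinitePlaces M F :=
    isUnramifiedAtInfinitePlaces_of_algHom (IsScalarTower.toAlgHom M F E)
  have hunrF : ∀ v : HeightOneSpectrum (𝓞 M), Algebra.IsUnramifiedIn (𝓞 F) v.asIdeal := by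
    intro v q hq hqv
    haveI := hq
    have hq0 : q ≠ ⊥ := by
      intro h0
      apply v.ne_bot
      rw [hqv.over, h0, Ideal.under_def, Ideal.comap_bot_of_injective _
        (FaithfulSMul.algebraMap_injective (𝓞 M) (𝓞 F))]
    haveI : q.IsMaximal := hq.isMaximal hq0
    obtain ⟨Q, hQmax, hQq⟩ := Ideal.exists_maximal_ideal_liesOver_of_isIntegral (S := 𝓞 E) q
    haveI := hQmax
    have hq' : q = Q.under (𝓞 F) := hQq.over
    subst hq'
    rw [isUnramifiedAt_under_iff_inertia_le' F Q, hF, IntermediateField.fixingSubgroup_fixedField]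
    exact hIN Q
  -- ### `F/k` is normal: `ρ(N')` is normal in `Gal(E/k)` and `F = E^{ρ(N')}`
  haveI : (N'.map ρ).Normal := normal_map_commutator_sup_inertia_sup_pow p ρ hρ
  have hFk : F.restrictScalars k = IntermediateField.fixedField (N'.map ρ) := by
    ext x
    rw [IntermediateField.mem_restrictScalars, hF, IntermediateField.mem_fixedField_iff,
      IntermediateField.mem_fixedField_iff]
    constructor
    · rintro h _ ⟨n, hn, rfl⟩
      rw [hρ]
      exact h n hn
    · intro h n hn
      rw [← hρ]
      exact h (ρ n) ⟨n, hn, rfl⟩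
  haveI : Normal k F := by
    have h1 : IsGalois k (IntermediateField.fixedField (N'.map ρ)) := IsGalois.of_fixedField_normal_subgroup (N'.map ρ)
    have h2 : Normal k (F.restrictScalars k) := by rw [hFk]; exact h1.to_normal
    exact h2
  -- ### a copy of `F` inside the Hilbert class field `H` of `M`; `H` as an `F`-algebra
  haveI : NumberField F := NumberField.of_module_finite M F
  haveI : Algebra.IsAlgebraic M F := Algebra.IsAlgebraic.of_finite M F
  let ι₀ : F →ₐ[M] AlgebraicClosure M := IsAlgClosed.lift
  let F' : IntermediateField M (AlgebraicClosure M) := ι₀.fieldRange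
  let e : F ≃ₐ[M] F' := AlgEquiv.ofInjectiveField ι₀
  haveI : FiniteDimensional M F' := LinearEquiv.finiteDimensional e.toLinearEquiv
  haveI : IsAbelianGalois M F' := IsAbelianGalois.of_algHom e.symm.toAlgHom
  haveI : NumberField F' := NumberField.of_module_finite M F'
  haveI : IsUnramifiedAtInfinitePlaces M F' := isUnramifiedAtInfinitePlaces_of_algHom e.symm.toAlgHom
  have hunr' := forall_isUnramifiedIn_of_algHom e.symm.toAlgHom hunrF
  have hle : F' ≤ hilbertClassField M := hilbertClassField.le_hilbertClassField M F' hunr'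
  let ι : F →ₐ[M] hilbertClassField M := (IntermediateField.inclusion hle).comp (e : F →ₐ[M] F')
  letI : Algebra F (hilbertClassField M) := ι.toRingHom.toAlgebra
  haveI : IsScalarTower M F (hilbertClassField M) := IsScalarTower.of_algebraMap_eq fun x => (ι.commutes x).symm
  haveI : IsScalarTower k M (hilbertClassField M) :=
    IsScalarTower.of_algebraMap_eq fun x => Subtype.ext (IsScalarTower.algebraMap_apply k M (AlgebraicClosure M) x)
  haveI : IsScalarTower k F (hilbertClassField M) := IsScalarTower.of_algebraMap_eq fun x => by
    rw [IsScalarTower.algebraMap_apply k M (hilbertClassField M) x,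
      IsScalarTower.algebraMap_apply M F (hilbertClassField M) (algebraMap k M x), ← IsScalarTower.algebraMap_apply k M F x]
  haveI : IsGalois k (hilbertClassField M) := hilbertClassField.isGalois_of_isGalois M
  -- ### centrality: step (iii-a) upstairs (`H/M` mod `p`-th powers), exponent `p` downstairs (`F/M`)
  have hcentH : ∀ (τ : hilbertClassField M ≃ₐ[k] hilbertClassField M)
      (a a' : hilbertClassField M ≃ₐ[M] hilbertClassField M), (∀ y, a' y = τ (a (τ.symm y))) →
      ∃ e' : hilbertClassField M ≃ₐ[M] hilbertClassField M, a' = e' ^ p * a :=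
    fun τ a a' h => hilbertClassField.exists_eq_pow_mul_of_classGroup_mulEquiv M p τ (τ.restrictNormal M)
      (fun x => (AlgEquiv.restrictNormal_commutes τ M x).symm) (hσ _) a a' h
  have hcentF : ∀ (τ : F ≃ₐ[k] F) (b b' : F ≃ₐ[M] F), (∀ y, b' y = τ (b (τ.symm y))) → b' = b :=
    conj_eq_of_central_mod_pow (k := k) (F := M) (E := F) (H := hilbertClassField M) p hcentH hexp
  -- ### conclusion: `⁅τ, a⁆` acts trivially on `F`, i.e. lies in `N' = Gal(E/F)`
  rw [Subgroup.commutator_le]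
  rintro τ - b ⟨a, rfl⟩
  exact commutator_mem_map_of_central N' F hF ρ hρ hcentF τ a

end Main

end Literature.NumberTheory.NumberFields

end
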